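import Mathlib

/-!
# Lemma B: relations among all-X output vectors are CHARGE syzygies

Helper file for the crux stmt-ValiantsHypothesis-7391 (negative lane; blueprint
`Cruxes/PeelingLemma/DETERMINISTIC-ALLX.md` §2, module [B] of its Lean plan; p1's Lemma B of
`ALLX-PROOF-SKETCH.md`, the refuter's F0).  In a (vector) all-X design with vertex vectors
`ψ x, ψ' x : Fin s → ℤ` and outputs `o_{i,1} = ψ (V i) + ψ' (W i)`, `o_{i,2} = ψ' (V i) + ψ (W i)`
(the shape of `AllXDesignsExist`, Theorems/PeelingLemma/Negative/PeelingLemmaFalseOfAllXDesignsExist.lean),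
a combination `Σ_i (u_i • o_{i,1} + u'_i • o_{i,2})` regroups vertex by vertex as
`Σ_x (c¹_x • ψ x + c²_x • ψ' x)` with the CHARGES

  `c¹_x = Σ_{i : V i = x} u_i + Σ_{i : W i = x} u'_i`,   `c²_x = Σ_{i : W i = x} u_i + Σ_{i : V i = x} u'_i`

(`sum_outputs_eq_sum_charges`).  When `ψ` and `ψ'` live on disjoint alphabets the two charge sums
must vanish separately (`charge_sums_eq_zero_of_disjoint`), and the total charges on the two sides
agree (`sum_charge_one_eq_sum_charge_two`, the global form of BALANCE).  Pure bookkeeping over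
`Mathlib`; no Theses import.
-/

namespace Summit.ValiantsHypothesis.ValiantsHypothesis.Theorems.PeelingLemmaCharges

-- summit = sub-problem name (single-conjunct summit, D-0017 layout), so the namespace repeats it
set_option linter.dupNamespace false

open scoped BigOperators
open Finset

/-- Regrouping a sum over outputs by the value of an index map: `Σ_i u_i • ψ (V i) =
Σ_x (Σ_{i : V i = x} u_i) • ψ x`. -/
theorem sum_smul_comp_eq_sum_fiber {n m : ℕ} {M : Type*} [AddCommGroup M] (ψ : Fin n → M)
    (V : Fin m → Fin n) (u : Fin m → ℤ) :
    ∑ i, u i • ψ (V i) = ∑ x, (∑ i ∈ univ.filter (fun i => V i = x), u i) • ψ x := by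
  rw [← Finset.sum_fiberwise univ V (fun i => u i • ψ (V i))]
  refine Finset.sum_congr rfl fun x _ => ?_
  rw [Finset.sum_smul]
  refine Finset.sum_congr rfl fun i hi => ?_
  rw [(Finset.mem_filter.mp hi).2]

/-- **Lemma B (regrouping).**  A combination of the `2m` output vectors of an all-X design is the
charge combination of the vertex vectors. -/
theorem sum_outputs_eq_sum_charges {n s m : ℕ} (ψ ψ' : Fin n → Fin s → ℤ) (V W : Fin m → Fin n)
    (u u' : Fin m → ℤ) :
    ∑ i, (u i • (ψ (V i) + ψ' (W i)) + u' i • (ψ' (V i) + ψ (W i))) =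
      ∑ x, ((∑ i ∈ univ.filter (fun i => V i = x), u i + ∑ i ∈ univ.filter (fun i => W i = x), u' i)
              • ψ x +
            (∑ i ∈ univ.filter (fun i => W i = x), u i + ∑ i ∈ univ.filter (fun i => V i = x), u' i)
              • ψ' x) := by
  have h1 := sum_smul_comp_eq_sum_fiber ψ V u
  have h2 := sum_smul_comp_eq_sum_fiber ψ' W u
  have h3 := sum_smul_comp_eq_sum_fiber ψ' V u'
  have h4 := sum_smul_comp_eq_sum_fiber ψ W u'
  simp only [smul_add, Finset.sum_add_distrib, add_smul]
  rw [h1, h2, h3, h4]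
  abel

/-- If `ψ` is supported inside the alphabet `Λ₁` and `ψ'` outside it, a vanishing charge combination
vanishes on each side separately. -/
theorem charge_sums_eq_zero_of_disjoint {n s : ℕ} (ψ ψ' : Fin n → Fin s → ℤ) (Λ₁ : Finset (Fin s))
    (hψ : ∀ x μ, μ ∉ Λ₁ → ψ x μ = 0) (hψ' : ∀ x μ, μ ∈ Λ₁ → ψ' x μ = 0) (c₁ c₂ : Fin n → ℤ)
    (h : ∑ x, (c₁ x • ψ x + c₂ x • ψ' x) = 0) :
    ∑ x, c₁ x • ψ x = 0 ∧ ∑ x, c₂ x • ψ' x = 0 := by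
  have hμ : ∀ μ, (∑ x, c₁ x * ψ x μ) + (∑ x, c₂ x * ψ' x μ) = 0 := by
    intro μ
    have := congrFun h μ
    simpa [Finset.sum_apply, Pi.add_apply, Pi.smul_apply, smul_eq_mul, Finset.sum_add_distrib]
      using this
  constructor
  · funext μ
    simp only [Finset.sum_apply, Pi.smul_apply, smul_eq_mul, Pi.zero_apply]
    by_cases hm : μ ∈ Λ₁
    · have h2 : ∑ x, c₂ x * ψ' x μ = 0 :=
        Finset.sum_eq_zero fun x _ => by rw [hψ' x μ hm, mul_zero]
      have := hμ μ; rw [h2, add_zero] at this; exact this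
    · exact Finset.sum_eq_zero fun x _ => by rw [hψ x μ hm, mul_zero]
  · funext μ
    simp only [Finset.sum_apply, Pi.smul_apply, smul_eq_mul, Pi.zero_apply]
    by_cases hm : μ ∈ Λ₁
    · exact Finset.sum_eq_zero fun x _ => by rw [hψ' x μ hm, mul_zero]
    · have h1 : ∑ x, c₁ x * ψ x μ = 0 :=
        Finset.sum_eq_zero fun x _ => by rw [hψ x μ hm, mul_zero]
      have := hμ μ; rw [h1, zero_add] at this; exact this

/-- **Balance (global form).**  The total charge is the same on both sides:
`Σ_x c¹_x = Σ_i (u_i + u'_i) = Σ_x c²_x`. -/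
theorem sum_charge_one_eq_sum_charge_two {n m : ℕ} (V W : Fin m → Fin n) (u u' : Fin m → ℤ) :
    ∑ x, (∑ i ∈ univ.filter (fun i => V i = x), u i + ∑ i ∈ univ.filter (fun i => W i = x), u' i) =
      ∑ x, (∑ i ∈ univ.filter (fun i => W i = x), u i +
        ∑ i ∈ univ.filter (fun i => V i = x), u' i) := by
  simp only [Finset.sum_add_distrib]
  rw [Finset.sum_fiberwise univ V u, Finset.sum_fiberwise univ W u',
    Finset.sum_fiberwise univ W u, Finset.sum_fiberwise univ V u']

/-- **Lemma B for relations.**  If `(u, u')` is a vector relation among the outputs of an all-X design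
whose two families of vertex vectors live on disjoint alphabets, then both charge syzygies hold:
`Σ_x c¹_x • ψ x = 0` and `Σ_x c²_x • ψ' x = 0`. -/
theorem charge_syzygies_of_relation {n s m : ℕ} (ψ ψ' : Fin n → Fin s → ℤ) (Λ₁ : Finset (Fin s))
    (hψ : ∀ x μ, μ ∉ Λ₁ → ψ x μ = 0) (hψ' : ∀ x μ, μ ∈ Λ₁ → ψ' x μ = 0) (V W : Fin m → Fin n)
    (u u' : Fin m → ℤ) (hrel : ∑ i, (u i • (ψ (V i) + ψ' (W i)) + u' i • (ψ' (V i) + ψ (W i))) = 0) :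
    ∑ x, (∑ i ∈ univ.filter (fun i => V i = x), u i + ∑ i ∈ univ.filter (fun i => W i = x), u' i)
        • ψ x = 0 ∧
      ∑ x, (∑ i ∈ univ.filter (fun i => W i = x), u i + ∑ i ∈ univ.filter (fun i => V i = x), u' i)
        • ψ' x = 0 := by
  rw [sum_outputs_eq_sum_charges] at hrel
  exact charge_sums_eq_zero_of_disjoint ψ ψ' Λ₁ hψ hψ' _ _ hrel

end Summit.ValiantsHypothesis.ValiantsHypothesis.Theorems.PeelingLemmaCharges
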